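import Summits.Ventures.HSemireg.Pad4TowerPsiSubA1

/-!
# Venture HSemireg — monad-4 g4: the FREE DOOR for (B3♯) — wall-free Hall margin `8` as a SUFFICIENT certificate of local
# freeness for every labelling, its ratio ∕ flow form (the exact LP instrument `flowlp.py`), and the origin-point Hall row

HONEST FRAMING.  Evidence cell `pub-hsemireg`, unit `hsemireg-monad-4` gen 4 (planner, MECH pen + typing; task «(B3)∕(α′)»).
Line of record (D-0145): stmt-HodgeConjecture-18881 `Cruxes/BlochSeedDiscOne/Lines/birth.lean` 814a6a70c14e831a, stub
`stub_rung_pad4_seedAt` — UNTOUCHED.  This file is the Lean PREDICATE SPEC of the g4 memo `B3SHARP-FREE-DOOR-monad4-g4.md`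
(same folder): DEFINITIONS with bodies and PROVED combinatorial lemmas extending g3's `B3SurplusLadder` (box designs, masses,
receivers `nbA`, transpose surplus, `MarginI`, `offWall`).  STANDALONE RENDERING: g3's module could not be imported on the farm when this
file was checked (rc 75 «remote:stale:unbuilt: …B3SurplusLadder», 2026-08-30 ≈ 01:00Z), so §0 below re-declares VERBATIM the g3
declarations this file uses (same names, same bodies, inside this file's namespace); every statement here becomes the corresponding statement
over g3's declarations by `rfl` once the two modules are co-importable, and §0 is then to be deleted in favour of the import.  It formalises NO algebraic geometry: the two LAWS below are pen
theorems of the memo (§1), recorded here as docstrings over the predicates they concern.  Nothing in this file is a step toward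
HC ∕ HC_CM ∕ HC_AV ∕ №4 ∕ 26512 ∕ 18881 ∕ H2; no `sorry`, no new axiom, no `instance`, no `notation`.

THE DOOR OF RECORD (director R19.257 ∕ R19.403): a two-term UP design `𝒫 →(i) 𝒩` on `X = S⁴`, `S = E₀²`, `dim X = 8`; cells
are 4-letter line bundles, an arc `π → ν` is LIVE when `Hom(L_π, L_ν)` has sections, and `E = coker i`.  In the language of
g3's `BoxDesign`: `A = ` the `P`-cells, `N = ` the `N`-cells, `C = ∅`, and the relevant rows are the `i`-side ones (`MarginI`).

LAW FD (FREE DOOR, memo §1 THEOREM FD; SUFFICIENT, EVERY labelling ∕ room).  Call an arc FREE when `Hom(L_π, L_ν)` is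
base-point free (on LINE supports: all four factor steps of class `Z` or `NF` = null of gcd `≥ 2`; walls = `NW`, null gcd `1`).
If the design has transpose Hall margin `≥ 8 = dim X` on the FREE sub-pattern — `FreeDoorI` below — then for a general choice of
the free entries of `i` (the wall entries arbitrary, fixed first) `i(x)` is injective at EVERY point `x ∈ X`; hence `E` is
locally free of rank `m(𝒩) − m(𝒫)` and `c(E) = c(𝒩) ∕ c(𝒫)`.  (Incidence count: for fixed `x` the free entries evaluate ONTO
the pattern space, in which the non-injective matrices have codimension `≥ margin + 1 ≥ 9 > dim X`.)

LAW OH (ORIGIN-POINT HALL, memo §1; NECESSARY in any room whose wall curves share a point — the plain ∕ origin-aligned room of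
record does, colour-1 R10-ORIGIN law, idea-crit-hsem-3 PASS l.9059).  At that point only free arcs evaluate non-trivially, so
injectivity there needs plain Hall on the free sub-pattern — `OriginHallI` below (rung `0`; colour-1's R10 puts ONE factor at
the origin, this row puts all four).

INSTRUMENT (memo §3): `MarginI (offWall L W) D 8` for SOME integer orbit-constant design on a support with the class rows
`(H1)` and the sign row is decided by ONE exact LP — the `G`-symmetric RATIO FLOW LP — because (THEOREM RS below, proved here)
a ratio-`p∕q` flow certificate with `p > q` gives strict Hall, and `8 •` a strict-Hall design has margin `8`; conversely
(Gale's supply–demand theorem, pen) ratio-Hall designs carry ratio flows, and `G`-averaging makes the flow orbit-symmetric.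
VERDICTS (memo §4, exact): S′ (h = 14, 265c6121…, σ = −Im) and S131 (h = 16, fbe4f2dd…, σ = +Im): FREE DOOR OPEN — certified
locally free orbit-constant designs exist (smallest found: rank 256 on S′, rank 312 on S131) — but EVERY orbit-constant design
on either support is capacity-dead at the `μ′`-carrying `N`-orbit (memo §5 «carrier starvation», Farkas certificates): local
freeness is not the binding constraint of the seed search; carrier capacity is.
-/

set_option linter.dupNamespace false

namespace Summit.HodgeConjecture.HodgeConjecture.Cruxes.BlochSeedDiscOne.B3FreeDoor

open Finset

section Generic

variable {V : Type*}

/-! ## §0 Verbatim copies of the g3 declarations used (from `B3SurplusLadder.lean`, tree a89c2e1f…; delete when importable) -/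

/-- [g3 copy] a box design over a cell type `V`: supports `A, N, C` and integer multiplicities. -/
structure BoxDesign (V : Type*) where
  A : Finset V
  N : Finset V
  C : Finset V
  mA : V → ℤ
  mN : V → ℤ
  mC : V → ℤ

/-- [g3 copy] the mass of a block. -/
def mass (m : V → ℤ) (S : Finset V) : ℤ := ∑ Z ∈ S, m Z

theorem mass_empty (m : V → ℤ) : mass m (∅ : Finset V) = 0 := by simp [mass]

theorem mass_mono {m : V → ℤ} {s t : Finset V} (hst : s ⊆ t) (hpos : ∀ i ∈ t, 0 ≤ m i) : mass m s ≤ mass m t :=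
  Finset.sum_le_sum_of_subset_of_nonneg hst fun i hi _ => hpos i hi

/-- [g3 copy] feeders of a `C`-block. -/
def nbC (L : V → V → Prop) [DecidableRel L] (D : BoxDesign V) (Γ : Finset V) : Finset V :=
  D.N.filter fun n => ∃ c ∈ Γ, L n c

/-- [g3 copy] receivers of an `A`-block. -/
def nbA (L : V → V → Prop) [DecidableRel L] (D : BoxDesign V) (Γ : Finset V) : Finset V :=
  D.N.filter fun n => ∃ a ∈ Γ, L a n

theorem nbA_subset (L : V → V → Prop) [DecidableRel L] (D : BoxDesign V) (Γ : Finset V) : nbA L D Γ ⊆ D.N :=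
  Finset.filter_subset _ _

theorem nbA_empty (L : V → V → Prop) [DecidableRel L] (D : BoxDesign V) : nbA L D ∅ = ∅ := by
  unfold nbA; simp

/-- [g3 copy] surplus of a `C`-block. -/
def surplusC (L : V → V → Prop) [DecidableRel L] (D : BoxDesign V) (Γ : Finset V) : ℤ :=
  mass D.mN (nbC L D Γ) - mass D.mC Γ

/-- [g3 copy] transpose surplus of an `A`-block. -/
def surplusA (L : V → V → Prop) [DecidableRel L] (D : BoxDesign V) (Γ : Finset V) : ℤ :=
  mass D.mN (nbA L D Γ) - mass D.mA Γ

/-- [g3 copy] Hall row, `i`-side. -/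
def HallI (L : V → V → Prop) [DecidableRel L] (D : BoxDesign V) : Prop :=
  ∀ Γ ∈ D.A.powerset, mass D.mA Γ ≤ mass D.mN (nbA L D Γ)

/-- [g3 copy] strict Hall row, `i`-side. -/
def StrictHallI (L : V → V → Prop) [DecidableRel L] (D : BoxDesign V) : Prop :=
  ∀ Γ ∈ D.A.powerset, Γ.Nonempty → mass D.mA Γ < mass D.mN (nbA L D Γ)

/-- [g3 copy] the rung `d`, `q`-side. -/
def MarginQ (L : V → V → Prop) [DecidableRel L] (D : BoxDesign V) (d : ℤ) : Prop :=
  ∀ Γ ∈ D.C.powerset, Γ.Nonempty → d ≤ surplusC L D Γ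

/-- [g3 copy] the rung `d`, `i`-side. -/
def MarginI (L : V → V → Prop) [DecidableRel L] (D : BoxDesign V) (d : ℤ) : Prop :=
  ∀ Γ ∈ D.A.powerset, Γ.Nonempty → d ≤ surplusA L D Γ

theorem hallI_iff_marginI_zero (L : V → V → Prop) [DecidableRel L] (D : BoxDesign V) : HallI L D ↔ MarginI L D 0 := by
  constructor
  · intro h Γ hΓ _
    have := h Γ hΓ
    unfold surplusA; linarith
  · intro h Γ hΓ
    rcases Γ.eq_empty_or_nonempty with rfl | hne
    · rw [nbA_empty, mass_empty, mass_empty]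
    · have := h Γ hΓ hne
      unfold surplusA at this; linarith

theorem strictHallI_iff_marginI_one (L : V → V → Prop) [DecidableRel L] (D : BoxDesign V) :
    StrictHallI L D ↔ MarginI L D 1 := by
  constructor
  · intro h Γ hΓ hne
    have := h Γ hΓ hne
    unfold surplusA; linarith
  · intro h Γ hΓ hne
    have := h Γ hΓ hne
    unfold surplusA at this; linarith

theorem marginI_mono (L : V → V → Prop) [DecidableRel L] (D : BoxDesign V) {d d' : ℤ} (hd : d' ≤ d)
    (h : MarginI L D d) : MarginI L D d' :=
  fun Γ hΓ hne => le_trans hd (h Γ hΓ hne)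

theorem hallI_of_marginI (L : V → V → Prop) [DecidableRel L] (D : BoxDesign V) {d : ℤ} (hd : 0 ≤ d)
    (h : MarginI L D d) : HallI L D :=
  (hallI_iff_marginI_zero L D).2 (marginI_mono L D hd h)

theorem nbA_mono {L L' : V → V → Prop} [DecidableRel L] [DecidableRel L'] (hLL : ∀ x y, L' x y → L x y)
    (D : BoxDesign V) (Γ : Finset V) : nbA L' D Γ ⊆ nbA L D Γ := by
  intro n hn
  simp only [nbA, Finset.mem_filter] at hn ⊢
  obtain ⟨hN, a, ha, hl⟩ := hn
  exact ⟨hN, a, ha, hLL _ _ hl⟩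

theorem surplusA_mono_rel {L L' : V → V → Prop} [DecidableRel L] [DecidableRel L'] (hLL : ∀ x y, L' x y → L x y)
    (D : BoxDesign V) (hpos : ∀ n ∈ D.N, 0 ≤ D.mN n) (Γ : Finset V) : surplusA L' D Γ ≤ surplusA L D Γ := by
  have := mass_mono (m := D.mN) (nbA_mono hLL D Γ) fun i hi => hpos i (nbA_subset L D Γ hi)
  unfold surplusA; linarith

theorem marginI_of_finer {L L' : V → V → Prop} [DecidableRel L] [DecidableRel L'] (hLL : ∀ x y, L' x y → L x y)
    (D : BoxDesign V) (hpos : ∀ n ∈ D.N, 0 ≤ D.mN n) {d : ℤ} (h : MarginI L' D d) : MarginI L D d :=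
  fun Γ hΓ hne => le_trans (h Γ hΓ hne) (surplusA_mono_rel hLL D hpos Γ)

/-- [g3 copy] the pattern off a wall predicate. -/
abbrev offWall (L W : V → V → Prop) : V → V → Prop := fun x y => L x y ∧ ¬ W x y

theorem offWall_le (L W : V → V → Prop) : ∀ x y, offWall L W x y → L x y := fun _ _ h => h.1

theorem marginI_offWall {L W : V → V → Prop} [DecidableRel L] [DecidableRel W] (D : BoxDesign V)
    (hpos : ∀ n ∈ D.N, 0 ≤ D.mN n) {d : ℤ} (h : MarginI (offWall L W) D d) : MarginI L D d :=
  marginI_of_finer (offWall_le L W) D hpos h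

theorem not_marginI_of_block {L : V → V → Prop} [DecidableRel L] {D : BoxDesign V} {Γ : Finset V} {d : ℤ}
    (hΓ : Γ ⊆ D.A) (hne : Γ.Nonempty) (hlt : surplusA L D Γ < d) : ¬ MarginI L D d :=
  fun h => absurd (h Γ (Finset.mem_powerset.mpr hΓ) hne) (not_le.mpr hlt)

/-! ## §1 Scaling a design: margins scale, strict Hall `× 8` is margin `8` -/

/-- the design with every multiplicity multiplied by `k` (same supports). -/
def scale (k : ℤ) (D : BoxDesign V) : BoxDesign V where
  A := D.A
  N := D.N
  C := D.C
  mA := fun v => k * D.mA v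
  mN := fun v => k * D.mN v
  mC := fun v => k * D.mC v

theorem mass_scale (k : ℤ) (m : V → ℤ) (S : Finset V) : mass (fun v => k * m v) S = k * mass m S := by
  unfold mass; rw [Finset.mul_sum]

theorem nbA_scale (L : V → V → Prop) [DecidableRel L] (k : ℤ) (D : BoxDesign V) (Γ : Finset V) :
    nbA L (scale k D) Γ = nbA L D Γ := rfl

theorem nbC_scale (L : V → V → Prop) [DecidableRel L] (k : ℤ) (D : BoxDesign V) (Γ : Finset V) :
    nbC L (scale k D) Γ = nbC L D Γ := rfl

/-- transpose surplus is linear in the design. -/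
theorem surplusA_scale (L : V → V → Prop) [DecidableRel L] (k : ℤ) (D : BoxDesign V) (Γ : Finset V) :
    surplusA L (scale k D) Γ = k * surplusA L D Γ := by
  show mass (fun v => k * D.mN v) (nbA L (scale k D) Γ) - mass (fun v => k * D.mA v) Γ = k * surplusA L D Γ
  rw [nbA_scale, mass_scale, mass_scale]
  unfold surplusA; ring

theorem surplusC_scale (L : V → V → Prop) [DecidableRel L] (k : ℤ) (D : BoxDesign V) (Γ : Finset V) :
    surplusC L (scale k D) Γ = k * surplusC L D Γ := by
  show mass (fun v => k * D.mN v) (nbC L (scale k D) Γ) - mass (fun v => k * D.mC v) Γ = k * surplusC L D Γ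
  rw [nbC_scale, mass_scale, mass_scale]
  unfold surplusC; ring

/-- **SCALING**: rung `d` for `D` gives rung `k·d` for `k • D` (`k ≥ 0`). -/
theorem marginI_scale (L : V → V → Prop) [DecidableRel L] (D : BoxDesign V) {d k : ℤ} (hk : 0 ≤ k)
    (h : MarginI L D d) : MarginI L (scale k D) (k * d) := by
  intro Γ hΓ hne
  rw [surplusA_scale]
  exact mul_le_mul_of_nonneg_left (h Γ hΓ hne) hk

theorem marginQ_scale (L : V → V → Prop) [DecidableRel L] (D : BoxDesign V) {d k : ℤ} (hk : 0 ≤ k)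
    (h : MarginQ L D d) : MarginQ L (scale k D) (k * d) := by
  intro Γ hΓ hne
  rw [surplusC_scale]
  exact mul_le_mul_of_nonneg_left (h Γ hΓ hne) hk

/-- **`8 •` (strict Hall) = margin `8`**: every integer design passing STRICT transpose Hall under a pattern, multiplied by
`8 = dim X`, passes the sufficient rung `8` under that pattern.  (So «free door open on a support» = «strict free-Hall is
feasible», a rational-LP question.) -/
theorem marginI_eight_of_strictHallI (L : V → V → Prop) [DecidableRel L] (D : BoxDesign V) (h : StrictHallI L D) :
    MarginI L (scale 8 D) 8 := by
  have h1 : MarginI L D 1 := (strictHallI_iff_marginI_one L D).mp h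
  have h8 := marginI_scale L D (by norm_num : (0 : ℤ) ≤ 8) h1
  simpa using h8

/-! ## §2 Ratio Hall and ratio flow certificates (the LP instrument's certificate, weak duality proved) -/

/-- RATIO-`p∕q` transpose Hall: every `A`-block `Γ` has `p · m_A(Γ) ≤ q · m_N(N(Γ))` (the free-Hall RATIO rows of the memo,
`p∕q = 1 + ε`; as linear rows in the multiplicities they are valid for EVERY design on the support — unused cells only loosen). -/
def RatioHallI (L : V → V → Prop) [DecidableRel L] (D : BoxDesign V) (p q : ℤ) : Prop :=
  ∀ Γ ∈ D.A.powerset, p * mass D.mA Γ ≤ q * mass D.mN (nbA L D Γ)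

/-- ratio `> 1` with positive `A`-multiplicities gives STRICT Hall. -/
theorem strictHallI_of_ratioHallI (L : V → V → Prop) [DecidableRel L] (D : BoxDesign V) {p q : ℤ} (hq : 0 < q)
    (hpq : q < p) (hpos : ∀ a ∈ D.A, 1 ≤ D.mA a) (h : RatioHallI L D p q) : StrictHallI L D := by
  intro Γ hΓ hne
  have hΓA : Γ ⊆ D.A := Finset.mem_powerset.mp hΓ
  have hm : 1 ≤ mass D.mA Γ := by
    obtain ⟨a, ha⟩ := hne
    have hsub : ({a} : Finset V) ⊆ Γ := Finset.singleton_subset_iff.mpr ha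
    have hle : mass D.mA {a} ≤ mass D.mA Γ :=
      mass_mono hsub fun i hi => le_trans zero_le_one (hpos i (hΓA hi))
    have hsing : mass D.mA {a} = D.mA a := by unfold mass; rw [Finset.sum_singleton]
    linarith [hpos a (hΓA ha)]
  have hr := h Γ hΓ
  by_contra hle
  rw [not_lt] at hle
  have h1 : q * mass D.mN (nbA L D Γ) ≤ q * mass D.mA Γ := mul_le_mul_of_nonneg_left hle hq.le
  have h2 : q * mass D.mA Γ < p * mass D.mA Γ := mul_lt_mul_of_pos_right hpq (by linarith)
  linarith

/-- A RATIO-`p∕q` FLOW CERTIFICATE, `i`-side: an integer flow on live arcs `a → n` (`n ∈ N`) taking at least `p · m_A(a)` out of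
each `a ∈ A` and putting at most `q · m_N(n)` into each `n ∈ N`.  The optimal solution of the memo's `G`-symmetric flow LP
(`flowlp.py`), cleared of denominators, IS such a certificate with `p∕q = 1 + ε`. -/
structure RatioFlowCertI (L : V → V → Prop) (D : BoxDesign V) (p q : ℤ) where
  /-- the flow on arcs `a → n` -/
  f : V → V → ℤ
  nonneg : ∀ a n, 0 ≤ f a n
  live : ∀ a n, f a n ≠ 0 → n ∈ D.N ∧ L a n
  supply : ∀ n ∈ D.N, ∑ a ∈ D.A, f a n ≤ q * D.mN n
  demand : ∀ a ∈ D.A, p * D.mA a ≤ ∑ n ∈ D.N, f a n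

/-- **WEAK DUALITY (ratio form)**: a ratio flow certificate proves the ratio-Hall rows (every block). -/
theorem ratioHallI_of_flowCert {L : V → V → Prop} [DecidableRel L] {D : BoxDesign V} {p q : ℤ}
    (F : RatioFlowCertI L D p q) : RatioHallI L D p q := by
  intro Γ hΓ
  have hΓA : Γ ⊆ D.A := Finset.mem_powerset.mp hΓ
  have h1 : p * mass D.mA Γ ≤ ∑ a ∈ Γ, ∑ n ∈ D.N, F.f a n := by
    unfold mass
    rw [Finset.mul_sum]
    exact Finset.sum_le_sum fun a ha => F.demand a (hΓA ha)
  have h2 : ∑ a ∈ Γ, ∑ n ∈ D.N, F.f a n = ∑ n ∈ D.N, ∑ a ∈ Γ, F.f a n := Finset.sum_comm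
  have h3 : ∑ n ∈ D.N, ∑ a ∈ Γ, F.f a n = ∑ n ∈ nbA L D Γ, ∑ a ∈ Γ, F.f a n := by
    symm
    apply Finset.sum_subset (nbA_subset L D Γ)
    intro n hn hnot
    apply Finset.sum_eq_zero
    intro a ha
    by_contra hne0
    apply hnot
    simp only [nbA, Finset.mem_filter]
    exact ⟨hn, a, ha, (F.live a n hne0).2⟩
  have h4 : ∑ n ∈ nbA L D Γ, ∑ a ∈ Γ, F.f a n ≤ q * mass D.mN (nbA L D Γ) := by
    unfold mass
    rw [Finset.mul_sum]
    apply Finset.sum_le_sum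
    intro n hn
    have hnN : n ∈ D.N := nbA_subset L D Γ hn
    calc ∑ a ∈ Γ, F.f a n ≤ ∑ a ∈ D.A, F.f a n :=
          Finset.sum_le_sum_of_subset_of_nonneg hΓA fun a _ _ => F.nonneg a n
      _ ≤ q * D.mN n := F.supply n hnN
  linarith

/-- **THEOREM RS (the instrument's certificate, end to end)**: a ratio-`p∕q` flow certificate with `p > q > 0` on a design
with positive `A`-multiplicities makes `8 •` the design pass the rung `8` under the same pattern.  With the pattern = the FREE
sub-pattern this is the hypothesis of LAW FD (pen): `8 • D` has a locally free cokernel of the design class. -/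
theorem marginI_eight_of_ratioFlowCert {L : V → V → Prop} [DecidableRel L] {D : BoxDesign V} {p q : ℤ} (hq : 0 < q)
    (hpq : q < p) (hpos : ∀ a ∈ D.A, 1 ≤ D.mA a) (F : RatioFlowCertI L D p q) : MarginI L (scale 8 D) 8 :=
  marginI_eight_of_strictHallI L D (strictHallI_of_ratioHallI L D hq hpq hpos (ratioHallI_of_flowCert F))

/-! ## §3 The two rows of the free door as predicates over a live pattern `L` and a wall predicate `W` -/

/-- **FREE DOOR (LAW FD, sufficient for EVERY labelling)**: transpose Hall margin `8 = dim X` on the FREE sub-pattern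
`offWall L W` (`W a n`: the arc `a → n` has a factor step whose Hom bundle has base points — class `NW` on LINE supports, also
`AU` off the line).  Pen consequence: generic `i` injective at every point, `E = coker i` locally free, `c(E) = c(𝒩)∕c(𝒫)`. -/
def FreeDoorI (L W : V → V → Prop) [DecidableRel L] [DecidableRel W] (D : BoxDesign V) : Prop :=
  MarginI (offWall L W) D 8

/-- **ORIGIN-POINT HALL (LAW OH, necessary in any room whose wall curves share a point)**: plain transpose Hall on the free
sub-pattern. -/
def OriginHallI (L W : V → V → Prop) [DecidableRel L] [DecidableRel W] (D : BoxDesign V) : Prop :=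
  HallI (offWall L W) D

/-- the free door contains the origin-point Hall row … -/
theorem originHallI_of_freeDoorI {L W : V → V → Prop} [DecidableRel L] [DecidableRel W] {D : BoxDesign V}
    (h : FreeDoorI L W D) : OriginHallI L W D :=
  hallI_of_marginI (offWall L W) D (by norm_num) h

/-- … and g3's sufficient rung `8` of the OPEN stratum (RB-MILP's «SURPLUS ≥ 8» on the full live pattern), which is strictly
weaker: the full-pattern rung certifies injectivity only off the walls. -/
theorem openRung_of_freeDoorI {L W : V → V → Prop} [DecidableRel L] [DecidableRel W] {D : BoxDesign V}
    (hpos : ∀ n ∈ D.N, 0 ≤ D.mN n) (h : FreeDoorI L W D) : MarginI L D 8 :=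
  marginI_offWall D hpos h

/-- the free door from a ratio flow certificate on the free sub-pattern (how the machine verdict «OPEN, witness» is read). -/
theorem freeDoorI_scale_eight_of_ratioFlowCert {L W : V → V → Prop} [DecidableRel L] [DecidableRel W] {D : BoxDesign V}
    {p q : ℤ} (hq : 0 < q) (hpq : q < p) (hpos : ∀ a ∈ D.A, 1 ≤ D.mA a) (F : RatioFlowCertI (offWall L W) D p q) :
    FreeDoorI L W (scale 8 D) :=
  marginI_eight_of_ratioFlowCert hq hpq hpos F

/-- a printed free block with surplus `< 8` refutes the free door (the machine's FAIL line; e.g. D₃₃ on S′: a block on the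
`P`-orbits {41, 69, 70, 71} with free surplus `−15`). -/
theorem not_freeDoorI_of_block {L W : V → V → Prop} [DecidableRel L] [DecidableRel W] {D : BoxDesign V} {Γ : Finset V}
    (hΓ : Γ ⊆ D.A) (hne : Γ.Nonempty) (hlt : surplusA (offWall L W) D Γ < 8) : ¬ FreeDoorI L W D :=
  not_marginI_of_block hΓ hne hlt

end Generic

/-! ## §4 The shape of the smallest certified witness on S′ (memo §4): one free pencil-block per cell -/

/-- the per-cell shape of the S′ witness `{N18 : 8, N35 : 16, P70 : 8}` (×16 cells each): a `P70`-cell (cell `0`, mass `8`) whose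
only FREE receiver is one `N35`-cell (cell `1`, mass `16`; Hom = `𝒪(2,2,0)^{⊠3} ⊠ 𝒪`, bpf, `h⁰ = 8`), and an `N18`-cell (cell `2`,
mass `8`) that no free arc reaches (it splits off: the design is locally free and capacity-dead at once). -/
def witToy : BoxDesign (Fin 3) where
  A := {0}
  N := {1, 2}
  C := ∅
  mA := fun Z => if Z = 0 then 8 else 0
  mN := fun Z => if Z = 1 then 16 else if Z = 2 then 8 else 0
  mC := fun _ => 0

/-- live arcs of the toy: `0 → 1` (free) and nothing into `2` from `0` (the factor-4 step `(0,0,2)` is dead). -/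
abbrev witToyLive : Fin 3 → Fin 3 → Prop := fun x y => x = 0 ∧ y = 1

/-- no wall arc in the toy (the one live arc is free). -/
abbrev witToyWall : Fin 3 → Fin 3 → Prop := fun _ _ => False

/-- the toy passes the free door: the only block `{0}` has free surplus `16 − 8 = 8`. -/
theorem witToy_freeDoorI : FreeDoorI witToyLive witToyWall witToy := by
  unfold FreeDoorI MarginI surplusA mass nbA witToy
  decide

/-- … and not rung `9`: the certificate is tight (margin exactly `dim X`). -/
theorem witToy_not_margin_nine : ¬ MarginI (offWall witToyLive witToyWall) witToy 9 := by
  unfold MarginI surplusA mass nbA witToy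
  decide

end Summit.HodgeConjecture.HodgeConjecture.Cruxes.BlochSeedDiscOne.B3FreeDoor
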